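import Summits.BirchSwinnertonDyer.Rank1Residual.X11b.Three.ClassRecordHalves
import Summits.BirchSwinnertonDyer.Rank1Residual.X11b.Three.HsiehDescent
import HarnessLib

/-!
# Class X11b at `p = 3` (team N8/O2 = cell `b2b-bsdres`, seat x11b3-p3): CLASS RECORD v4.4 — a
# READING of the class theorem of record with H1 = BDP-EXISTS@3 supplied FROM PRINT (Hsieh 2014
# Thm. 1, S18 (a) p258780) GIVEN the λ-supply hypothesis (S24-a, six clauses verbatim) and the ONE
# named descent residual `Three.HsiehDescentAt₃ W` (S24-b, p261034), CLASS-WIDE — the control input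
# CTL₀@3 being a theorem at every X11b@3 pair (`Three/CharTorsionClasswide.lean`, p260706)

HONEST FRAMING (verbatim, cell `b2b-bsdres`, run/shared/lean/b2b/bsd-rank1-residual/): the goal of
the cell is to DELETE the COMBINATION-SHAPED residual classes for ALL analytic-rank `≤ 1` curves
over `ℚ` — "full BSD formula for every rank `≤ 1` curve in class `C`" assembled STRICTLY from
published theorems — so that the rank-`≤ 1` remainder becomes exactly the CONSTRUCTION-SHAPED
classes, which are TYPED (missing-input Props), NOT attempted; this is not "finishing BSD".
Team N8/O2 (X11b at `3`; RESIDUAL-MAP §I O2 OPEN). Research route; nothing booked; NO label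
changes. THEOREMS ONLY (no definition, no named fact, no `sorry`). Lead rulings R7-60 / R8-5
(x11b3-lead GEN 6/7): v4.4 is a READING of the record (the class theorem of record stays
p254011 / v4.2 until the referee countersigns v4.3 and the lead names it); the conjecture binder
`Three.HsiehDescentAt₃ W` and the six-clause λ-supply hypothesis appear BY NAME / VERBATIM as labelled
OPEN hypotheses (REFEREE A3); sub-populations BY NAME in the types (REFEREE A1); no new def.

## What this file does

S18 (x11b3-lit1 (a) `Literature/…/AnticyclotomicRankinSelbergPAdicLFunction.lean`, p258780; x11b3-p7
(b) `Three/BDPExistsFromPrint.lean`, p259417) proved `Three.bdpExistsAt₃_of_hsieh2014 :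
hsieh2014_exists_anticyclotomicPAdicLFunction → HsiehFrameResidualAt₃ W → BDPExistsAt₃ W`; S24
(x11b3-p7 / r1, `Three/HsiehDescent.lean`, p261034) split the ONE residual LOSSLESSLY as
`(λ-supply) ∧ HsiehDescentAt₃ W` (`hsiehFrameResidualAt₃_of_descent`,
`bdpExistsAt₃_of_hsieh2014_of_descent`) and drew the A1 corollaries through x11b3-p2's A1-only CTL₀
theorem (`CharTorsionOnA1.lean`: (ram) ∧ `3 ∤ ∏c`, three extra cited facts
`poitouTate_selmerStructure_duality` / `poitouTate_sha_tateDual` / `fieldCdLE_two_of_numberField`).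
With CTL₀ a theorem at EVERY X11b@3 pair (`Three.charTorsionAt₃_of_classX11b`, p260706, from
`kolyvagin` + `poitouTate_sum_localTatePairing_eq_zero` + `localEulerPoincareCharacteristic` — facts S0's
record already carries) the same readings hold CLASS-WIDE:

* §1 **`stepLAt_of_halves₃_of_classX11b_of_hsieh2014`** (S18 currency: the bundled residual) and
  **`stepLAt_of_halves₃_of_classX11b_of_hsieh2014_of_descent`** (S24 currency: λ-supply hypothesis +
  `HsiehDescentAt₃ W`) — at EVERY X11b@3 pair `… ∧ H2 ∧ H3 ⟹ Three.StepLAt W`; class-wide twins of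
  the `…_onA1_of_hsieh2014[_of_descent]` corollaries with (ram) ∧ `3 ∤ ∏c` and the three A1-only cited
  facts dropped.
* §2 **`bsdp_of_halves₃_classwide_of_hsieh2014_of_descent`** — S0's statement of record
  (`Three.bsdp_of_halves₃_classwide`: the twelve published facts of `Three.bsdp_of_stepLAt` + (T2′)₃ +
  (T4″)₃, NO control binder) with H1 ↦ Hsieh 2014 Thm. 1 (`hH`) + λ-supply (`hsup`) + per pair
  `HsiehDescentAt₃ W ∧ BDPValueAt₃ W ∧ IMCDivAt₃ W`.
* §3 **`forall_bsdp_of_classRecord_v44`** — CLASS RECORD v4.4 (a READING of v4.3,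
  `Three/ClassRecordHalves.lean` p261173): the H1 conjunct of the road-(b) / road-(d) HALVES binders
  REPLACED by ONE more PUBLISHED fact (Hsieh 2014 Thm. 1, `hH`; 21 published binders in all), the
  λ-supply hypothesis `hsup` (S24-a VERBATIM; a theorem of class field theory not yet in the tree — a
  HYPOTHESIS until then) and the named descent residual per road (`hDb` / `hDd : … → HsiehDescentAt₃ W`);
  H2 ∧ H3 stay (`hHb` / `hHd`). §4 **`forall_missingInputAt_of_classRecord_v44`** — the same in the
  currency of the cell's typed residual `X11Three.MissingInputAt W` (REFEREE R6.2).

WORDING OF RECORD (REFEREE H45, lead R8-11): S24 does not "shrink" the open remainder at `3 ‖ N` — its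
open content is UNCHANGED = (t) = `HsiehDescentAt₃ W`; S24 buys the (λ)-conjunct as a CFT theorem target
(S24-a, here the hypothesis `hsup`) and the licence to USE Hsieh's printed `Q, Ω_p, C` in a descent
proof: v4.4 "reads (t) GIVEN (λ)". WHAT IS LEFT of X11b@3 read through v4.4, by named sub-population
(binders; TRUE-OPEN counts are EVIDENCE, rmap-3 / x11b3 CLASS RECORD v4.2, unchanged by this file):
road (a) NONSPLIT(3) ∧ (ram) [722]: ONE per-pair input `ClassClosure.RegulatorNonvanishingAt W 3`; road
(b) SPLIT(3) ∧ (ram) [961]: `HsiehDescentAt₃ W` GIVEN λ-supply [(t), not in print at `3 ∣ N`], H2 =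
BDP-VALUE@3 [Cas18 Thm. 3.2 at `3 ∣ N`, not in print], H3 = MI-W3 [no source at `3`] + the (T2′)₃
binders `hSh` / `hUα` / `hUγ` off A1; road (d) [1]: the same + `hU₀`; the (T4″)₃ corner [0 TRUE-OPEN]:
`hCL` / `hCT` / `hCU`. CONDITIONAL on every listed binder; nothing booked; O2 OPEN; X11 ∧ `r = 1` ∧
`p = 3` stays CONSTRUCTION-SHAPED (R6.2); no label / count / mark moves.

References: [Hsieh2014] Thm. 1 (arXiv:1112.1580 pp. 3–4); [deShalit1987] II.1.4 (ii) (p. 35);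
[Castella2018] Thm. 2.3 (p. 5), Thm. 3.2 (p. 9), p. 9 l. 42, §5 (p. 12) (arXiv:1704.06608);
[GreenbergLNM1716] §3 Lemma 3.3; [MilneADT2006] I 2.8, I 4.10(b); [Kolyvagin1990] Thm. A;
[Skinner2016PacificMC] Thm. A, Thm. C; [SteinWuthrich2013] Thm. 6.1, §4.2; [Disegni2020] Thm. 1;
[MatarNekovar2019] Thm. 0.3; [BarriosEtAl2025] Thm. 5.1; [Wuthrich2014] Prop. 21; [Miller2011LMS]
Def. 1.1.
-/

noncomputable section

open scoped Classical

open WeierstrassCurve NumberField IsDedekindDomain Field Literature.NumberTheory.EllipticCurves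
  Rat.HeightOneSpectrum
  Literature.NumberTheory.DiophantineGeometry
  Literature.NumberTheory.EllipticCurves.GreenbergSelmer
  Literature.NumberTheory.EllipticCurves.ModularForms
  Literature.NumberTheory.EllipticCurves.Rank1Residual
  Literature.NumberTheory.EllipticCurves.Rank1Residual.Typed
  Literature.NumberTheory.EllipticCurves.Wuthrich2014
  Literature.NumberTheory.EllipticCurves.BalakrishnanEtAl2019
  Literature.NumberTheory.EllipticCurves.Skinner2016
  Literature.NumberTheory.EllipticCurves.SteinWuthrich2013
  Literature.NumberTheory.EllipticCurves.Disegni2020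
  Literature.NumberTheory.EllipticCurves.BarriosEtAl2025
  Literature.NumberTheory.QuadraticFields.Quadratic
  Literature.NumberTheory.Automorphic
  Literature.NumberTheory.GaloisRepresentations Literature.NumberTheory.GaloisCohomology
  Summit.BirchSwinnertonDyer.Rank1Residual.X11b.AcSelmer
  Summit.BirchSwinnertonDyer.Rank1Residual.X11b.LocBridge

namespace Summit.BirchSwinnertonDyer.Rank1Residual.X11b.Three

/-! ### §1. `Three.StepLAt W` at every X11b@3 pair from print + residual + H2 + H3 -/

/-- **`Three.StepLAt W` at EVERY X11b@3 pair from Hsieh 2014 Thm. 1 + the S18 residual + H2 + H3**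
(S18 currency): `Three.stepLAt_of_halves₃_of_classX11b` (CTL₀ discharged class-wide by Kolyvagin +
Poitou–Tate + the local Euler characteristic) with `h1` REPLACED by `bdpExistsAt₃_of_hsieh2014`.
Class-wide twin of `stepLAt_of_halves₃_onA1_of_hsieh2014` — no (ram), no `3 ∤ ∏ c_ℓ`, and the A1
corollary's three cited cohomological facts replaced by the one Poitou–Tate fact S0's record already
carries. CONDITIONAL on the four named facts, the named residual and the two typed halves; nothing
booked; O2 OPEN. [cite: Hsieh2014, Thm. 1 (arXiv:1112.1580 pp. 3–4)] [cite: Castella2018, Thm. 2.3 (p. 5), §5 (p. 12)]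
[cite: GreenbergLNM1716, §3 Lemma 3.3 (p. 87)] -/
theorem stepLAt_of_halves₃_of_classX11b_of_hsieh2014 {W : WeierstrassCurve ℚ} [W.IsElliptic]
    [W.IsGloballyMinimal] (hnf : exists_isNewformOf)
    (hKo : ∀ (N : ℕ) [NeZero N] (W : WeierstrassCurve ℚ) (K : Type) [Field K] [NumberField K],
      kolyvagin N W K)
    (hPT : ∀ (K : Type) [Field K] [NumberField K], poitouTate_sum_localTatePairing_eq_zero K)
    (hEP : ∀ (K : Type) [Field K] [NumberField K] (v : HeightOneSpectrum (𝓞 K)),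
      localEulerPoincareCharacteristic (v.adicCompletion K))
    (hH : hsieh2014_exists_anticyclotomicPAdicLFunction)
    (hX : ClassX11b W 3) (hres : HsiehFrameResidualAt₃ W) (h2 : BDPValueAt₃ W) (h3 : IMCDivAt₃ W) :
    StepLAt W :=
  stepLAt_of_halves₃_of_classX11b hnf hKo hPT hEP hX (bdpExistsAt₃_of_hsieh2014 W hH hres) h2 h3

/-- **`Three.StepLAt W` at EVERY X11b@3 pair from Hsieh 2014 Thm. 1 + λ-supply + the descent residual
+ H2 + H3** (S24 currency): as above with the S18 residual supplied by `hsiehFrameResidualAt₃_of_descent`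
from the λ-supply HYPOTHESIS `hsup` (the statement of S24-a `Three.lambdaSupplyAt₃` VERBATIM — a theorem
of class field theory not yet in the tree; no `def` introduced for it) and the ONE named descent
residual `hdesc : HsiehDescentAt₃ W` (S24-b, NOT in print at `3 ∣ N`). Class-wide twin of the A1
reading behind `bsdp_of_halves₃_onA1_of_hsieh2014_of_descent`. Reads (t) GIVEN (λ); nothing booked;
O2 OPEN. [cite: Hsieh2014, Thm. 1 (arXiv:1112.1580 pp. 3–4)] [cite: deShalit1987, II.1.4 Lemma (ii) (p. 35)]
[cite: Castella2018, p. 9 l. 42 (arXiv:1704.06608)] [cite: GreenbergLNM1716, §3 Lemma 3.3 (p. 87)] -/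
theorem stepLAt_of_halves₃_of_classX11b_of_hsieh2014_of_descent {W : WeierstrassCurve ℚ}
    [W.IsElliptic] [W.IsGloballyMinimal] (hnf : exists_isNewformOf)
    (hKo : ∀ (N : ℕ) [NeZero N] (W : WeierstrassCurve ℚ) (K : Type) [Field K] [NumberField K],
      kolyvagin N W K)
    (hPT : ∀ (K : Type) [Field K] [NumberField K], poitouTate_sum_localTatePairing_eq_zero K)
    (hEP : ∀ (K : Type) [Field K] [NumberField K] (v : HeightOneSpectrum (𝓞 K)),
      localEulerPoincareCharacteristic (v.adicCompletion K))
    (hH : hsieh2014_exists_anticyclotomicPAdicLFunction)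
    -- λ-SUPPLY at 3 (S24-a VERBATIM; a theorem of CFT, not yet in the tree — a HYPOTHESIS until then)
    (hsup : ∀ (ι' : PadicAlgCl 3 ≃+* ℂ) (K : Type) [Field K] [NumberField K] (κ : ZpExtension K 3),
      IsImaginaryQuadratic K → ((Ideal.span {(3 : ℤ)}).primesOver (𝓞 K)).ncard = 2 →
      κ.IsAnticyclotomic →
      ∃ (lam : HeckeCharacter K) (rlam : FramedGaloisRep K (PadicAlgCl 3) 1),
        lam.IsUnitary ∧ lam.HasInfinityType (fun _ ↦ (1 : ℤ)) (fun _ ↦ (-1 : ℤ)) ∧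
        (∀ x : ideleGroup ℚ, lam (AdeleRing.ideleBaseChange ℚ K x) = 1) ∧
        (∀ v : HeightOneSpectrum (𝓞 K), ((3 : ℕ) : 𝓞 K) ∉ v.asIdeal → lam.IsUnramifiedAt v) ∧
        IsPAdicAvatarOf ι' lam rlam ∧ FactorsThroughZp κ rlam)
    (hX : ClassX11b W 3) (hdesc : HsiehDescentAt₃ W) (h2 : BDPValueAt₃ W) (h3 : IMCDivAt₃ W) :
    StepLAt W :=
  stepLAt_of_halves₃_of_classX11b_of_hsieh2014 hnf hKo hPT hEP hH hX
    (hsiehFrameResidualAt₃_of_descent W hsup hdesc) h2 h3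

/-! ### §2. S0's statement of record: H1 from print GIVEN (λ), reading (t), class-wide -/

/-- **S0's statement of record with (T1)₃ supplied from print GIVEN λ-supply, reading the descent
residual, class-wide**: `Three.bsdp_of_halves₃_classwide` (`Three/CharTorsionClasswide.lean`: the
twelve published facts of `Three.bsdp_of_stepLAt` + (T2′)₃ + (T4″)₃, NO control binder) with the H1
conjunct REPLACED by Hsieh 2014 Thm. 1 (`hH`, published), the λ-supply hypothesis `hsup` (S24-a
verbatim) and, per X11b@3 pair with `ρ̄_{E,3}` onto, the named descent residual `HsiehDescentAt₃ W`
together with H2 ∧ H3 (`hR`). CONDITIONAL on every listed binder; nothing booked; RESIDUAL-MAP §I O2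
unchanged. [cite: Hsieh2014, Thm. 1 (arXiv:1112.1580 pp. 3–4)] [cite: deShalit1987, II.1.4 Lemma (ii) (p. 35)]
[cite: Castella2018, Thm. 2.3 (p. 5), Thm. 3.2 (p. 9), §5 (p. 12)] [cite: Skinner2016PacificMC, Thm. C (§1) and footnote 1]
[cite: Wuthrich2014, Prop. 21 (p. 400)] [cite: Miller2011LMS, Def. 1.1] -/
theorem bsdp_of_halves₃_classwide_of_hsieh2014_of_descent
    (hGZ : ∀ (N : ℕ) [NeZero N] (W : WeierstrassCurve ℚ) (K : Type) [Field K] [NumberField K],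
      gross_zagier N W K)
    (hKo : ∀ (N : ℕ) [NeZero N] (W : WeierstrassCurve ℚ) (K : Type) [Field K] [NumberField K],
      kolyvagin N W K)
    (hB : ∀ (N : ℕ) [NeZero N] (W : WeierstrassCurve ℚ) (K : Type) [Field K] [NumberField K],
      Kolyvagin1990_padicValNat_card_sha_le N W K)
    (hSk : Skinner2016.thmC_padicValRat_bsd_rank_zero) (hWu : sha_dvd_analyticSha)
    (hGZK : rank_eq_analyticRank_of_analyticRank_le_one) (hmod : hasEntireLFunction_rat)
    (hnf : exists_isNewformOf) (hHL : HoffsteinLuo1997_exists_twist_L_one_ne_zero)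
    (hMaz : mazur_not_dvd_maninConstant_of_odd)
    (hPT : ∀ (K : Type) [Field K] [NumberField K], poitouTate_sum_localTatePairing_eq_zero K)
    (hEP : ∀ (K : Type) [Field K] [NumberField K] (v : HeightOneSpectrum (𝓞 K)),
      localEulerPoincareCharacteristic (v.adicCompletion K))
    -- PUBLISHED: Hsieh 2014 Thm. 1 (S18 (a), p258780)
    (hH : hsieh2014_exists_anticyclotomicPAdicLFunction)
    -- λ-SUPPLY at 3 (S24-a VERBATIM; a theorem of CFT, not yet in the tree — a HYPOTHESIS until then)
    (hsup : ∀ (ι' : PadicAlgCl 3 ≃+* ℂ) (K : Type) [Field K] [NumberField K] (κ : ZpExtension K 3),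
      IsImaginaryQuadratic K → ((Ideal.span {(3 : ℤ)}).primesOver (𝓞 K)).ncard = 2 →
      κ.IsAnticyclotomic →
      ∃ (lam : HeckeCharacter K) (rlam : FramedGaloisRep K (PadicAlgCl 3) 1),
        lam.IsUnitary ∧ lam.HasInfinityType (fun _ ↦ (1 : ℤ)) (fun _ ↦ (-1 : ℤ)) ∧
        (∀ x : ideleGroup ℚ, lam (AdeleRing.ideleBaseChange ℚ K x) = 1) ∧
        (∀ v : HeightOneSpectrum (𝓞 K), ((3 : ℕ) : 𝓞 K) ∉ v.asIdeal → lam.IsUnramifiedAt v) ∧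
        IsPAdicAvatarOf ι' lam rlam ∧ FactorsThroughZp κ rlam)
    -- per pair: the ONE named descent residual (S24-b) + H2 ∧ H3 — TYPED, construction-shaped
    (hR : ∀ (W : WeierstrassCurve ℚ) [W.IsElliptic] [W.IsGloballyMinimal],
      ClassX11b W 3 → Surj W 3 → HsiehDescentAt₃ W ∧ BDPValueAt₃ W ∧ IMCDivAt₃ W)
    -- (T2′)₃ the Euler-system half off the unconditional atom (ram) ∧ `3 ∤ ∏ c_ℓ`
    (hU : ∀ (W : WeierstrassCurve ℚ) [W.IsElliptic] [W.IsGloballyMinimal],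
      ClassX11b W 3 → Surj W 3 → ¬ (Ram W 3 ∧ ¬ 3 ∣ W.tamagawaProduct) →
        Typed.MissingUpperBoundAt W 3)
    -- (T4″)₃ the non-surjective corner `3 ∣ ord₃ Δ_min`, no (ram) prime
    (hC : ∀ (W : WeierstrassCurve ℚ) [W.IsElliptic] [W.IsGloballyMinimal],
      ClassX11b W 3 → ¬ Surj W 3 → 3 ∣ padicValInt 3 W.minimalDiscriminantInt → ¬ Ram W 3 →
        Typed.MissingPPartAt W 3)
    (W : WeierstrassCurve ℚ) [W.IsElliptic] [W.IsGloballyMinimal] (hX : ClassX11b W 3) :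
    BSDp W 3 :=
  bsdp_of_halves₃_classwide hGZ hKo hB hSk hWu hGZK hmod hnf hHL hMaz hPT hEP
    (fun W _ _ hX hs ↦
      ⟨bdpExistsAt₃_of_hsieh2014_of_descent W hH hsup (hR W hX hs).1, (hR W hX hs).2⟩) hU hC W hX

/-! ### §3. CLASS RECORD v4.4 — the record read with H1 from print GIVEN (λ), residual (t) -/

/-- **X11b at `p = 3`, WHOLE CLASS — CLASS RECORD v4.4 IN KERNEL FORM (a READING of v4.3).**
`forall_bsdp_of_classRecord_v43` (p261173) with the H1 conjunct (`BDPExistsAt₃ W`) of the road-(b) /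
road-(d) HALVES binders REPLACED by the PUBLISHED fact Hsieh 2014 Thm. 1 (`hH :
hsieh2014_exists_anticyclotomicPAdicLFunction`, S18 (a)), the λ-supply HYPOTHESIS `hsup` (S24-a
`Three.lambdaSupplyAt₃` VERBATIM; a theorem of class field theory, not yet in the tree) and the ONE
named descent residual of S24 per road (`hDb` / `hDd : … → HsiehDescentAt₃ W`), via
`Three.bdpExistsAt₃_of_hsieh2014_of_descent`; H2 = BDP-VALUE@3 and H3 = MI-W3 stay (`hHb` / `hHd`).
Binder list: PUBLISHED (21) = v4.3's twenty + Hsieh 2014 Thm. 1; λ-supply `hsup`; road (a): `hReg`;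
road (b): `hDb`, `hHb`, `hSh`, `hUα`, `hUγ`; road (d): `hDd`, `hHd`, `hU₀`; corner: `hCL`, `hCT`, `hCU`.
The class theorem OF RECORD stays p254011 / v4.2 until the referee countersigns v4.3 and the lead names
it; v4.4 reads (t) GIVEN (λ). CONDITIONAL on every listed binder; nothing booked; labels UNCHANGED
(X11 ∧ `r = 1` ∧ `p = 3` CONSTRUCTION-SHAPED, R6.2; O2 OPEN).
[cite: Hsieh2014, Thm. 1 (arXiv:1112.1580 pp. 3–4)] [cite: deShalit1987, II.1.4 Lemma (ii) (p. 35)]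
[cite: Castella2018, Thm. 2.3 (p. 5), Thm. 3.2 (p. 9), §5 (p. 12)] [cite: GreenbergLNM1716, §3 Lemma 3.3 (p. 87)]
[cite: Skinner2016PacificMC, Thm. A and Thm. C (§1)] [cite: SteinWuthrich2013, Thm. 6.1, §4.2]
[cite: Disegni2020, Thm. 1 (§1.2)] [cite: MatarNekovar2019, Thm. 0.3 (p. 456)]
[cite: BarriosEtAl2025, Thm. 5.1 (rows R = I₀)] [cite: Wuthrich2014, Prop. 21 (p. 400)] [cite: Miller2011LMS, Def. 1.1] -/
theorem forall_bsdp_of_classRecord_v44 [Fact (Nat.Prime 3)]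
    -- PUBLISHED: the twelve named facts of route p2
    (hGZ : ∀ (N : ℕ) [NeZero N] (W : WeierstrassCurve ℚ) (K : Type) [Field K] [NumberField K],
      gross_zagier N W K)
    (hKo : ∀ (N : ℕ) [NeZero N] (W : WeierstrassCurve ℚ) (K : Type) [Field K] [NumberField K],
      kolyvagin N W K)
    (hB : ∀ (N : ℕ) [NeZero N] (W : WeierstrassCurve ℚ) (K : Type) [Field K] [NumberField K],
      Kolyvagin1990_padicValNat_card_sha_le N W K)
    (hSk : Skinner2016.thmC_padicValRat_bsd_rank_zero) (hWu : sha_dvd_analyticSha)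
    (hGZK : rank_eq_analyticRank_of_analyticRank_le_one) (hmod : hasEntireLFunction_rat)
    (hnf : exists_isNewformOf) (hHL : HoffsteinLuo1997_exists_twist_L_one_ne_zero)
    (hMaz : mazur_not_dvd_maninConstant_of_odd)
    (hPT : ∀ (K : Type) [Field K] [NumberField K], poitouTate_sum_localTatePairing_eq_zero K)
    (hEP : ∀ (K : Type) [Field K] [NumberField K] (v : HeightOneSpectrum (𝓞 K)),
      localEulerPoincareCharacteristic (v.adicCompletion K))
    -- PUBLISHED: Friedberg–Hoffstein, Barrios et al. 2025 (binder at `2`), road (a)'s five,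
    -- Matar–Nekovář 2019 Thm. 0.3 (the corner's `K`-bound), Hsieh 2014 Thm. 1 (S18 (a))
    (hFH : friedbergHoffstein_exists_twist_ne_zero_inertAt)
    (hBR : localTamagawaNumber_quadraticTwist_two_mem_of_goodReduction)
    (hSkA : thmA_charIdeal_multiplicative) (hJn : thm61_nonsplitMultiplicative)
    (hHn : exists_isMultCanonical) (hD : thm1_padicBSD_rankOne_multiplicative)
    (hpar : nonempty_modularParametrizationData)
    (hMN : ∀ (N : ℕ) [NeZero N] (W : WeierstrassCurve ℚ) (K : Type) [Field K] [NumberField K],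
      MatarNekovar2019.thm03_padicValNat_card_sha_le_of_irreducible N W K)
    (hH : hsieh2014_exists_anticyclotomicPAdicLFunction)
    -- λ-SUPPLY at 3 (S24-a VERBATIM; a theorem of CFT, not yet in the tree — a HYPOTHESIS until then)
    (hsup : ∀ (ι' : PadicAlgCl 3 ≃+* ℂ) (K : Type) [Field K] [NumberField K] (κ : ZpExtension K 3),
      IsImaginaryQuadratic K → ((Ideal.span {(3 : ℤ)}).primesOver (𝓞 K)).ncard = 2 →
      κ.IsAnticyclotomic →
      ∃ (lam : HeckeCharacter K) (rlam : FramedGaloisRep K (PadicAlgCl 3) 1),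
        lam.IsUnitary ∧ lam.HasInfinityType (fun _ ↦ (1 : ℤ)) (fun _ ↦ (-1 : ℤ)) ∧
        (∀ x : ideleGroup ℚ, lam (AdeleRing.ideleBaseChange ℚ K x) = 1) ∧
        (∀ v : HeightOneSpectrum (𝓞 K), ((3 : ℕ) : 𝓞 K) ∉ v.asIdeal → lam.IsUnramifiedAt v) ∧
        IsPAdicAvatarOf ι' lam rlam ∧ FactorsThroughZp κ rlam)
    -- ROAD (a) NONSPLIT(3) ∧ (ram): ONE per-pair input
    (hReg : ∀ (W : WeierstrassCurve ℚ) [W.IsElliptic] [W.IsGloballyMinimal],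
      ClassX11b W 3 → Ram W 3 → ¬ W.HasSplitMultiplicativeReductionAtPrime 3 →
        ClassClosure.RegulatorNonvanishingAt W 3)
    -- ROAD (b) SPLIT(3) ∧ (ram): the ONE named descent residual (S24-b), H2 ∧ H3, displays on pure-β,
    -- α / γ∖α
    (hDb : ∀ (W : WeierstrassCurve ℚ) [W.IsElliptic] [W.IsGloballyMinimal],
      ClassX11b W 3 → Ram W 3 → W.HasSplitMultiplicativeReductionAtPrime 3 → HsiehDescentAt₃ W)
    (hHb : ∀ (W : WeierstrassCurve ℚ) [W.IsElliptic] [W.IsGloballyMinimal],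
      ClassX11b W 3 → Ram W 3 → W.HasSplitMultiplicativeReductionAtPrime 3 →
        BDPValueAt₃ W ∧ IMCDivAt₃ W)
    (hSh : ∀ (W : WeierstrassCurve ℚ) [W.IsElliptic] [W.IsGloballyMinimal],
      ClassX11b W 3 → Ram W 3 → W.HasSplitMultiplicativeReductionAtPrime 3 → ¬ ShapeAlpha W →
        ¬ ShapeGamma W → 3 ∣ W.tamagawaProduct → P2ShimuraDisplaysAt W 3)
    (hUα : ∀ (W : WeierstrassCurve ℚ) [W.IsElliptic] [W.IsGloballyMinimal],
      ClassX11b W 3 → Ram W 3 → ShapeAlpha W → Typed.MissingUpperBoundAt W 3)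
    (hUγ : ∀ (W : WeierstrassCurve ℚ) [W.IsElliptic] [W.IsGloballyMinimal],
      ClassX11b W 3 → Ram W 3 → W.HasSplitMultiplicativeReductionAtPrime 3 → ¬ ShapeAlpha W →
        ShapeGamma W → Typed.MissingUpperBoundAt W 3)
    -- ROAD (d) `¬Ram ∧ Surj`: the descent residual, H2 ∧ H3, the upper half
    (hDd : ∀ (W : WeierstrassCurve ℚ) [W.IsElliptic] [W.IsGloballyMinimal],
      ClassX11b W 3 → ¬ Ram W 3 → Surj W 3 → HsiehDescentAt₃ W)
    (hHd : ∀ (W : WeierstrassCurve ℚ) [W.IsElliptic] [W.IsGloballyMinimal],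
      ClassX11b W 3 → ¬ Ram W 3 → Surj W 3 → BDPValueAt₃ W ∧ IMCDivAt₃ W)
    (hU₀ : ∀ (W : WeierstrassCurve ℚ) [W.IsElliptic] [W.IsGloballyMinimal],
      ClassX11b W 3 → Surj W 3 → ¬ Ram W 3 → Typed.MissingUpperBoundAt W 3)
    -- THE (T4″)@3 CORNER `¬Surj` (x11b3-p8's typed inputs, `CornerResidual.lean`, p253638)
    (hCL : ∀ (W : WeierstrassCurve ℚ) [W.IsElliptic] [W.IsGloballyMinimal], CornerStepLAt W)
    (hCT : ∀ (W : WeierstrassCurve ℚ) [W.IsElliptic] [W.IsGloballyMinimal], CornerTwistAt W)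
    (hCU : ∀ (W : WeierstrassCurve ℚ) [W.IsElliptic] [W.IsGloballyMinimal], CornerUpperAt W)
    (W : WeierstrassCurve ℚ) [W.IsElliptic] [W.IsGloballyMinimal] (hX : ClassX11b W 3) :
    BSDp W 3 :=
  forall_bsdp_of_classRecord_v43 hGZ hKo hB hSk hWu hGZK hmod hnf hHL hMaz hPT hEP hFH hBR hSkA hJn
    hHn hD hpar hMN hReg
    (fun W _ _ hX hram hsplit ↦
      ⟨bdpExistsAt₃_of_hsieh2014_of_descent W hH hsup (hDb W hX hram hsplit), hHb W hX hram hsplit⟩)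
    hSh hUα hUγ
    (fun W _ _ hX hnram hsurj ↦
      ⟨bdpExistsAt₃_of_hsieh2014_of_descent W hH hsup (hDd W hX hnram hsurj), hHd W hX hnram hsurj⟩)
    hU₀ hCL hCT hCU W hX

/-! ### §4. CLASS RECORD v4.4 in the currency of the cell's typed residual -/

/-- **CLASS RECORD v4.4 ⟹ the CLASS's typed missing input at every X11b@3 pair.** Under exactly the
binders of `forall_bsdp_of_classRecord_v44` (21 published facts; λ-supply; road (a)'s per-pair
`RegulatorNonvanishingAt W 3`; road (b)'s / road (d)'s descent residual `HsiehDescentAt₃ W`, H2 ∧ H3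
and (T2′)₃ binders; the corner's three typed inputs), the typed residual of RESIDUAL-MAP §I O2 /
REFEREE R6.2, `X11Three.MissingInputAt W`, holds at every pair of the class
(`X11Three.missingInputAt_of_bsdp`). CONDITIONAL; nothing booked; O2 OPEN; no label change.
[cite: Miller2011LMS, §1 and Def. 1.1] [cite: Hsieh2014, Thm. 1 (arXiv:1112.1580 pp. 3–4)]
[cite: Castella2018, Thm. 2.3 (p. 5), Thm. 3.2 (p. 9), §5 (p. 12)] [cite: Skinner2016PacificMC, Thm. A and Thm. C (§1)]
[cite: Disegni2020, Thm. 1 (§1.2)] [cite: MatarNekovar2019, Thm. 0.3 (p. 456)] [cite: BarriosEtAl2025, Thm. 5.1 (rows R = I₀)] -/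
theorem forall_missingInputAt_of_classRecord_v44 [Fact (Nat.Prime 3)]
    (hGZ : ∀ (N : ℕ) [NeZero N] (W : WeierstrassCurve ℚ) (K : Type) [Field K] [NumberField K],
      gross_zagier N W K)
    (hKo : ∀ (N : ℕ) [NeZero N] (W : WeierstrassCurve ℚ) (K : Type) [Field K] [NumberField K],
      kolyvagin N W K)
    (hB : ∀ (N : ℕ) [NeZero N] (W : WeierstrassCurve ℚ) (K : Type) [Field K] [NumberField K],
      Kolyvagin1990_padicValNat_card_sha_le N W K)
    (hSk : Skinner2016.thmC_padicValRat_bsd_rank_zero) (hWu : sha_dvd_analyticSha)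
    (hGZK : rank_eq_analyticRank_of_analyticRank_le_one) (hmod : hasEntireLFunction_rat)
    (hnf : exists_isNewformOf) (hHL : HoffsteinLuo1997_exists_twist_L_one_ne_zero)
    (hMaz : mazur_not_dvd_maninConstant_of_odd)
    (hPT : ∀ (K : Type) [Field K] [NumberField K], poitouTate_sum_localTatePairing_eq_zero K)
    (hEP : ∀ (K : Type) [Field K] [NumberField K] (v : HeightOneSpectrum (𝓞 K)),
      localEulerPoincareCharacteristic (v.adicCompletion K))
    (hFH : friedbergHoffstein_exists_twist_ne_zero_inertAt)
    (hBR : localTamagawaNumber_quadraticTwist_two_mem_of_goodReduction)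
    (hSkA : thmA_charIdeal_multiplicative) (hJn : thm61_nonsplitMultiplicative)
    (hHn : exists_isMultCanonical) (hD : thm1_padicBSD_rankOne_multiplicative)
    (hpar : nonempty_modularParametrizationData)
    (hMN : ∀ (N : ℕ) [NeZero N] (W : WeierstrassCurve ℚ) (K : Type) [Field K] [NumberField K],
      MatarNekovar2019.thm03_padicValNat_card_sha_le_of_irreducible N W K)
    (hH : hsieh2014_exists_anticyclotomicPAdicLFunction)
    (hsup : ∀ (ι' : PadicAlgCl 3 ≃+* ℂ) (K : Type) [Field K] [NumberField K] (κ : ZpExtension K 3),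
      IsImaginaryQuadratic K → ((Ideal.span {(3 : ℤ)}).primesOver (𝓞 K)).ncard = 2 →
      κ.IsAnticyclotomic →
      ∃ (lam : HeckeCharacter K) (rlam : FramedGaloisRep K (PadicAlgCl 3) 1),
        lam.IsUnitary ∧ lam.HasInfinityType (fun _ ↦ (1 : ℤ)) (fun _ ↦ (-1 : ℤ)) ∧
        (∀ x : ideleGroup ℚ, lam (AdeleRing.ideleBaseChange ℚ K x) = 1) ∧
        (∀ v : HeightOneSpectrum (𝓞 K), ((3 : ℕ) : 𝓞 K) ∉ v.asIdeal → lam.IsUnramifiedAt v) ∧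
        IsPAdicAvatarOf ι' lam rlam ∧ FactorsThroughZp κ rlam)
    (hReg : ∀ (W : WeierstrassCurve ℚ) [W.IsElliptic] [W.IsGloballyMinimal],
      ClassX11b W 3 → Ram W 3 → ¬ W.HasSplitMultiplicativeReductionAtPrime 3 →
        ClassClosure.RegulatorNonvanishingAt W 3)
    (hDb : ∀ (W : WeierstrassCurve ℚ) [W.IsElliptic] [W.IsGloballyMinimal],
      ClassX11b W 3 → Ram W 3 → W.HasSplitMultiplicativeReductionAtPrime 3 → HsiehDescentAt₃ W)
    (hHb : ∀ (W : WeierstrassCurve ℚ) [W.IsElliptic] [W.IsGloballyMinimal],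
      ClassX11b W 3 → Ram W 3 → W.HasSplitMultiplicativeReductionAtPrime 3 →
        BDPValueAt₃ W ∧ IMCDivAt₃ W)
    (hSh : ∀ (W : WeierstrassCurve ℚ) [W.IsElliptic] [W.IsGloballyMinimal],
      ClassX11b W 3 → Ram W 3 → W.HasSplitMultiplicativeReductionAtPrime 3 → ¬ ShapeAlpha W →
        ¬ ShapeGamma W → 3 ∣ W.tamagawaProduct → P2ShimuraDisplaysAt W 3)
    (hUα : ∀ (W : WeierstrassCurve ℚ) [W.IsElliptic] [W.IsGloballyMinimal],
      ClassX11b W 3 → Ram W 3 → ShapeAlpha W → Typed.MissingUpperBoundAt W 3)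
    (hUγ : ∀ (W : WeierstrassCurve ℚ) [W.IsElliptic] [W.IsGloballyMinimal],
      ClassX11b W 3 → Ram W 3 → W.HasSplitMultiplicativeReductionAtPrime 3 → ¬ ShapeAlpha W →
        ShapeGamma W → Typed.MissingUpperBoundAt W 3)
    (hDd : ∀ (W : WeierstrassCurve ℚ) [W.IsElliptic] [W.IsGloballyMinimal],
      ClassX11b W 3 → ¬ Ram W 3 → Surj W 3 → HsiehDescentAt₃ W)
    (hHd : ∀ (W : WeierstrassCurve ℚ) [W.IsElliptic] [W.IsGloballyMinimal],
      ClassX11b W 3 → ¬ Ram W 3 → Surj W 3 → BDPValueAt₃ W ∧ IMCDivAt₃ W)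
    (hU₀ : ∀ (W : WeierstrassCurve ℚ) [W.IsElliptic] [W.IsGloballyMinimal],
      ClassX11b W 3 → Surj W 3 → ¬ Ram W 3 → Typed.MissingUpperBoundAt W 3)
    (hCL : ∀ (W : WeierstrassCurve ℚ) [W.IsElliptic] [W.IsGloballyMinimal], CornerStepLAt W)
    (hCT : ∀ (W : WeierstrassCurve ℚ) [W.IsElliptic] [W.IsGloballyMinimal], CornerTwistAt W)
    (hCU : ∀ (W : WeierstrassCurve ℚ) [W.IsElliptic] [W.IsGloballyMinimal], CornerUpperAt W)
    (W : WeierstrassCurve ℚ) [W.IsElliptic] [W.IsGloballyMinimal] (hX : ClassX11b W 3) :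
    X11Three.MissingInputAt W :=
  X11Three.missingInputAt_of_bsdp hmod hGZK W (le_of_eq hX.1)
    (forall_bsdp_of_classRecord_v44 hGZ hKo hB hSk hWu hGZK hmod hnf hHL hMaz hPT hEP hFH hBR hSkA hJn
      hHn hD hpar hMN hH hsup hReg hDb hHb hSh hUα hUγ hDd hHd hU₀ hCL hCT hCU W hX)

end Summit.BirchSwinnertonDyer.Rank1Residual.X11b.Three

end
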